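import Literature.MathematicalPhysics.KineticTheory.ReyBelletThomas2002Thm21Irreducible
import Literature.MathematicalPhysics.KineticTheory.ReyBelletThomas2002Control
import Literature.Analysis.Hypoelliptic.HormanderProof
import HarnessLib

/-!
# Rey-Bellet–Thomas 2002, Theorem 2.1 from Theorem 3.10 and Hörmander's theorem

Trunk T-KINETIC (Literature/MathematicalPhysics/KineticTheory). Inline decomposition step for the
named fact `ReyBelletThomas2002_thm21` (provefact unit), discharging the IRREDUCIBILITY hypothesis
of `ReyBelletThomas2002_thm21_of_thm310_of_irreducible_of_hormander`
(`ReyBelletThomas2002Thm21Irreducible.lean`) by Proposition 4.2 of the paper, now PROVED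
(`OscillatorChain.rb_irreducible`, `ReyBelletThomas2002Control.lean`: support theorem +
controllability of the control system (46), the latter under H1 alone), and the HÖRMANDER
hypothesis by the tree's proof of Hörmander's theorem
(`Literature.Analysis.Hypoelliptic.hormander1967_thm11_proof`, Kohn's method). After this file the
named fact rests on exactly ONE input:

* **Theorem 3.10 of the paper** — the Liapunov bound (39), `T^s e^{θG} ≤ κ e^{θG} + L 1_U` with
  `κ < 1` on the complement of a compact set, for the constructed kernels `rbKernel` (§3 of the
  paper: scaling limit of the Hamiltonian dynamics at high energy, Thm 3.3, Prop. 3.7, Cor. 3.8).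

* `ReyBelletThomas2002_thm21_of_thm310_of_hormander` — Theorem 2.1 from Thm 3.10 and the named
  fact `Hormander1967_thm11` as a hypothesis;
* `ReyBelletThomas2002_thm21_of_thm310` — Theorem 2.1 from Thm 3.10 alone.

## References

* L. Rey-Bellet, L. E. Thomas, Comm. Math. Phys. **225** (2002) 305–329, Thm 2.1, Thm 3.10,
  Props. 4.1–4.2, §5.
* L. Hörmander, Acta Math. **119** (1967) 147–171, Thm 1.1.
-/

noncomputable section

open MeasureTheory Set
open scoped NNReal ENNReal

namespace Literature.MathematicalPhysics.KineticTheory.HeatConduction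

open Literature.Analysis.Distribution (Hormander1967_thm11)

/-- **Rey-Bellet–Thomas 2002, Theorem 2.1 (`ReyBelletThomas2002_thm21`) from Theorem 3.10 and
Hörmander's theorem.** Assume Hörmander 1967 Thm 1.1 (`hH`, the named fact) and, for the
constructed transition kernels `rbKernel` of (RBT-SDE) under the hypotheses of Theorem 2.1, the
Liapunov bound of Theorem 3.10 as printed (`h310`: for every `s > 0` and
`0 < θ < 1/max(T_L, T_R)` there are a compact `U`, `κ < 1` and `L` with
`(T^s e^{θG})(x) ≤ κ e^{θG(x)} + L 1_U(x)` for all `x`). Then Theorem 2.1 holds: the semigroup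
(constructed, `rbSemigroup`), joint `C^∞` transition densities (forward and backward equations +
Hörmander), irreducibility (Prop. 4.2, proved), the minorisation, Krylov–Bogoliubov and Harris'
theorem (§5), the smooth everywhere positive invariant density, exponential convergence in the
`e^{θG}`-norm and decay of correlations. [cite: ReyBelletThomas2002, Thm 2.1] -/
theorem ReyBelletThomas2002_thm21_of_thm310_of_hormander (hH : Hormander1967_thm11)
    (h310 : ∀ (P : OscillatorChain) (Λ : ℝ) (k₁ k₂ : ℝ), 2 ≤ k₁ → k₁ ≤ k₂ →
      RBGrowth P.U k₁ → RBGrowth P.V k₂ → RBNondegenerate P.V → 0 < P.γ → 0 < Λ →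
      ∀ (N : ℕ) (T_L T_R : ℝ), 2 ≤ N → 0 < T_L → 0 < T_R →
        ∀ s : ℝ≥0, 0 < s → ∀ θ : ℝ, 0 < θ → θ < 1 / max T_L T_R →
          ∃ (U : Set (RBPhaseSpace N)) (κ L : ℝ), IsCompact U ∧ κ < 1 ∧
            ∀ x, ∫⁻ y, ENNReal.ofReal (Real.exp (θ * P.rbEnergy N y)) ∂(P.rbKernel Λ N T_L T_R s x) ≤
              ENNReal.ofReal (κ * Real.exp (θ * P.rbEnergy N x) + L * U.indicator 1 x)) :
    ReyBelletThomas2002_thm21 :=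
  ReyBelletThomas2002_thm21_of_thm310_of_irreducible_of_hormander hH h310
    fun P Λ k₁ k₂ hk₁ hk₁₂ hU hV _ hγ hΛ N T_L T_R hN hL hR z U hUo hne =>
      OscillatorChain.rb_irreducible hU hV (by linarith) (by linarith) hγ.le hγ hΛ.ne' (by omega)
        hL hR z U hUo hne

/-- **Rey-Bellet–Thomas 2002, Theorem 2.1 (`ReyBelletThomas2002_thm21`) from Theorem 3.10 alone.**
Hörmander's theorem is the tree's `hormander1967_thm11_proof`; the only remaining input is the
Liapunov bound of Theorem 3.10 for the constructed kernels. [cite: ReyBelletThomas2002, Thm 2.1] -/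
theorem ReyBelletThomas2002_thm21_of_thm310
    (h310 : ∀ (P : OscillatorChain) (Λ : ℝ) (k₁ k₂ : ℝ), 2 ≤ k₁ → k₁ ≤ k₂ →
      RBGrowth P.U k₁ → RBGrowth P.V k₂ → RBNondegenerate P.V → 0 < P.γ → 0 < Λ →
      ∀ (N : ℕ) (T_L T_R : ℝ), 2 ≤ N → 0 < T_L → 0 < T_R →
        ∀ s : ℝ≥0, 0 < s → ∀ θ : ℝ, 0 < θ → θ < 1 / max T_L T_R →
          ∃ (U : Set (RBPhaseSpace N)) (κ L : ℝ), IsCompact U ∧ κ < 1 ∧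
            ∀ x, ∫⁻ y, ENNReal.ofReal (Real.exp (θ * P.rbEnergy N y)) ∂(P.rbKernel Λ N T_L T_R s x) ≤
              ENNReal.ofReal (κ * Real.exp (θ * P.rbEnergy N x) + L * U.indicator 1 x)) :
    ReyBelletThomas2002_thm21 :=
  ReyBelletThomas2002_thm21_of_thm310_of_hormander
    Literature.Analysis.Hypoelliptic.hormander1967_thm11_proof h310

end Literature.MathematicalPhysics.KineticTheory.HeatConduction

end
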